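import Summits.QuantumAdvantage.QuantumAdvantage.Theorems.HolonomyDialStrategy

/-!
# HolonomyDial — Laws (cell decomp-qadv, seat lens-2, generation 13; supports item 26531 `ExactnessDial.PolyLossOddU3`)

laws of the first node equation: `sepOfDec`, `binPtrWin_of_decode`, `holDecodeLoss3_of_binPointerLoss3`, `binPointerPerfect3_of_noPerfectConst3`, `node_iff`, `noPerfectOdd3_of_polyLossOddU3`, `closes` (reaching `AdviceFreeQNC0Three` BY NAME), `closes_T`.

Split (≤ 400 lines, part 2/11) of the node file `HOME/decomp-qadv-lens-2/g13/HolonomyDial.lean` (v5, sha256 fb2c0281…,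
farm rc 0, no placeholders); declarations verbatim, namespace `Summit.QuantumAdvantage.QuantumAdvantage.Theorems.HolonomyDial`.
Record: NODE-g13.md.
-/

set_option linter.dupNamespace false

noncomputable section
open scoped Classical

namespace Summit.QuantumAdvantage.QuantumAdvantage.Theorems

open Finset
open Literature.Computability.QuantumComplexity Literature.Computability.QuantumComplexity.RingHLF
open Literature.Computability.MetaComplexity Literature.Computability.MetaComplexity.Smolensky
open Summit.QuantumAdvantage.AdviceFreeQNC0
open Summit.QuantumAdvantage.QuantumAdvantage.Theses (ExactnessDial.PolyLossOddU3 ExactnessDial.NoPerfectOdd3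
  ExactnessDial.NoPerfectConst3 ExactnessDial.MassStep3u ExactnessDial.OddToAll3 ExactnessDial.DPLift3
  ExactnessDial.MultiRingBridge3 ExactnessDial.closes)

namespace HolonomyDial

/-! ### Necessity of the pieces -/

/-- `16 ≤ n → 4 ≤ log₂ n`. -/
theorem four_le_log (n : ℕ) (hn : 16 ≤ n) : 4 ≤ Nat.log 2 n := by
  rw [show (16 : ℕ) = 2 ^ 4 by norm_num] at hn
  exact Nat.le_log_of_pow_le (by norm_num) hn

/-- degree bookkeeping: `2 + 2·(log₂ n)^c ≤ (log₂ n)^(c+1)` once `n ≥ 16`. -/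
theorem deg_bump (n c : ℕ) (hn : 16 ≤ n) :
    2 + ((Nat.log 2 n) ^ c + (Nat.log 2 n) ^ c) ≤ (Nat.log 2 n) ^ (c + 1) := by
  have hL := four_le_log n hn
  have hpos : 1 ≤ (Nat.log 2 n) ^ c := Nat.one_le_pow _ _ (by omega)
  rw [pow_succ]
  nlinarith

/-- **NECESSITY of the piece**: `PolyLossOddU3 → BinPointerLoss3` (the {0,1}-pointer steered by a degree-`(log n)^c`
polynomial is a degree-`(log n)^(c+1)` strategy; pointer dictionary). -/
theorem binPointerLoss3_of_polyLossOddU3 (h : ExactnessDial.PolyLossOddU3) : BinPointerLoss3 := by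
  obtain ⟨C, hC⟩ := h
  refine ⟨C, fun c => ?_⟩
  obtain ⟨n₀, hn₀⟩ := hC (c + 1)
  refine ⟨max n₀ 16, fun n hn f hf => ?_⟩
  have hn16 : 16 ≤ n := le_of_max_le_right hn
  have hP : ∀ i, ptrStrat f i ∈ lowDeg (ZMod 3) n ((Nat.log 2 n) ^ (c + 1)) := fun i =>
    lowDeg_mono (deg_bump n c hn16) (ptrStrat_mem hf i)
  have hle := hn₀ n (le_of_max_le_left hn) (ptrStrat f) hP
  have hset : (univ.filter fun x : Fin n → Bool => OddZeros x ∧ BinPtrWin f x) =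
      univ.filter fun x : Fin n → Bool => OddZeros x ∧ Rel x (fun i => decide (ptrStrat f i x = 1)) := by
    refine Finset.filter_congr fun x _ => ?_
    constructor
    · rintro ⟨hx, hw⟩; exact ⟨hx, (rel_ptrStrat_iff (by omega) f x hx).2 hw⟩
    · rintro ⟨hx, hr⟩; exact ⟨hx, (rel_ptrStrat_iff (by omega) f x hx).1 hr⟩
  rw [hset]
  exact hle

/-- the separator induced by a decoder: `f := (V + 1)²`, so that `f x = 1 ↔ V x ≠ 2`. -/
def sepOfDec {N : ℕ} (V : CubeFn (ZMod 3) N) : CubeFn (ZMod 3) N := (V + 1) * (V + 1)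

/-- Ring-game helper `sepOfDec_mem` (lens-2 law package; see the module docstring). -/
theorem sepOfDec_mem {N D : ℕ} {V : CubeFn (ZMod 3) N} (hV : V ∈ lowDeg (ZMod 3) N D) :
    sepOfDec V ∈ lowDeg (ZMod 3) N (D + D) := by
  have h1 : V + 1 ∈ lowDeg (ZMod 3) N D := Submodule.add_mem _ hV (one_mem_lowDeg D)
  exact mul_mem_lowDeg_add h1 h1

/-- Ring-game helper `sepOfDec_eq_one_iff` (lens-2 law package; see the module docstring). -/
theorem sepOfDec_eq_one_iff {N : ℕ} (V : CubeFn (ZMod 3) N) (x : Fin N → Bool) :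
    sepOfDec V x = 1 ↔ V x ≠ 2 := by
  simp only [sepOfDec, Pi.mul_apply, Pi.add_apply, Pi.one_apply]
  generalize V x = v
  revert v; decide

/-- a correct decoding of the holonomy makes the induced {0,1}-pointer win. -/
theorem binPtrWin_of_decode {N : ℕ} (V : CubeFn (ZMod 3) N) (x : Fin N → Bool)
    (hV : V x = ((hol x : ℕ) : ZMod 3)) : BinPtrWin (sepOfDec V) x := by
  have hW1 := Wk_one_le x
  have hhol : hol x < 3 := Nat.mod_lt _ (by norm_num)
  have hcast : ∀ a : ℕ, a < 3 → (((a : ZMod 3) ≠ 2) ↔ a ≠ 2) := by decide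
  constructor
  · intro h1
    rw [sepOfDec_eq_one_iff, hV, hcast _ hhol] at h1
    unfold gCond
    rw [Wk_zero]
    unfold hol Wtot at h1
    omega
  · intro h1
    rw [Ne, sepOfDec_eq_one_iff, hV, hcast _ hhol] at h1
    push Not at h1
    unfold gCond
    unfold hol Wtot at h1
    omega

/-- **NECESSITY of the rung**: `BinPointerLoss3 → HolDecodeLoss3` (a decoder steers a winning pointer). -/
theorem holDecodeLoss3_of_binPointerLoss3 (h : BinPointerLoss3) : HolDecodeLoss3 := by
  obtain ⟨C, hC⟩ := h
  refine ⟨C, fun c => ?_⟩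
  obtain ⟨n₀, hn₀⟩ := hC (c + 1)
  refine ⟨max n₀ 16, fun n hn V hV => ?_⟩
  have hn16 : 16 ≤ n := le_of_max_le_right hn
  have hf : sepOfDec V ∈ lowDeg (ZMod 3) n ((Nat.log 2 n) ^ (c + 1)) :=
    lowDeg_mono (le_trans (by omega) (deg_bump n c hn16)) (sepOfDec_mem hV)
  have hle := hn₀ n (le_of_max_le_left hn) (sepOfDec V) hf
  refine le_trans ?_ hle
  exact_mod_cast card_le_card fun x hx => by
    rw [mem_filter] at hx ⊢
    exact ⟨hx.1, hx.2.1, binPtrWin_of_decode V x hx.2.2⟩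

/-- exact grade: `NoPerfectConst3 → BinPointerPerfect3`. -/
theorem binPointerPerfect3_of_noPerfectConst3 (h : ExactnessDial.NoPerfectConst3) : BinPointerPerfect3 := by
  intro d
  obtain ⟨n₀, hn₀⟩ := h (2 + (d + d))
  refine ⟨max n₀ 3, fun n hn f hf => ?_⟩
  obtain ⟨x, hx, hnot⟩ := hn₀ n (le_of_max_le_left hn) (ptrStrat f) (fun i => ptrStrat_mem hf i)
  exact ⟨x, hx, fun hw => hnot ((rel_ptrStrat_iff (le_of_max_le_right hn) f x hx).2 hw)⟩

/-- exact grade: `BinPointerPerfect3 → HolDecodePerfect3`. -/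
theorem holDecodePerfect3_of_binPointerPerfect3 (h : BinPointerPerfect3) : HolDecodePerfect3 := by
  intro d
  obtain ⟨n₀, hn₀⟩ := h (d + d)
  refine ⟨n₀, fun n hn V hV => ?_⟩
  obtain ⟨x, hx, hnot⟩ := hn₀ n hn (sepOfDec V) (sepOfDec_mem hV)
  exact ⟨x, hx, fun hd => hnot (binPtrWin_of_decode V x hd)⟩

/-! ## §3 Node equation and `closes` -/

/-- **node kernel identity**: `T ⟺ BinPointerLoss3 ∧ PointerLift3` (piece necessary; lift = declared residual). -/
theorem node_iff : ExactnessDial.PolyLossOddU3 ↔ BinPointerLoss3 ∧ PointerLift3 :=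
  ⟨fun h => ⟨binPointerLoss3_of_polyLossOddU3 h, fun _ => h⟩, fun h => h.2 h.1⟩

/-- `PolyLossOddU3 → NoPerfectOdd3` (an inverse-polynomial loss on a class of `2^{n-1}` patterns is a loss). -/
theorem noPerfectOdd3_of_polyLossOddU3 (h : ExactnessDial.PolyLossOddU3) : ExactnessDial.NoPerfectOdd3 := by
  obtain ⟨C, hC⟩ := h
  intro c
  obtain ⟨n₀, hn₀⟩ := hC c
  refine ⟨max n₀ 3, fun n hn P hP => ?_⟩
  have hn3 : 3 ≤ n := le_of_max_le_right hn
  have hle := hn₀ n (le_of_max_le_left hn) P hP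
  by_contra hall
  push Not at hall
  -- then every odd pattern wins: the filtered set is the whole odd class, of size ≥ 2^(n-1)
  have hcard : 2 ^ (n - 1) ≤ (univ.filter fun x : Fin n → Bool =>
      OddZeros x ∧ Rel x (fun i => decide (P i x = 1))).card := by
    obtain ⟨m, rfl⟩ : ∃ m, n = m + 1 := ⟨n - 1, by omega⟩
    rw [Nat.add_sub_cancel]
    calc 2 ^ m ≤ (univ.filter fun x : Fin (m + 1) → Bool => OddZeros x).card :=
          Theorems.ExactnessDialOddToAll.two_pow_le_card_odd
      _ ≤ _ := card_le_card fun x hx => by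
          rw [mem_filter] at hx ⊢
          exact ⟨hx.1, hx.2, hall x hx.2⟩
  have h1 : ((2 : ℝ) ^ (n - 1)) ≤ ((univ.filter fun x : Fin n → Bool =>
      OddZeros x ∧ Rel x (fun i => decide (P i x = 1))).card : ℝ) := by exact_mod_cast hcard
  have hn1 : (1 : ℝ) ≤ (n : ℝ) ^ C := one_le_pow₀ (by exact_mod_cast (show 1 ≤ n by omega))
  have hpos : (0 : ℝ) < 1 / (n : ℝ) ^ C := by positivity
  have h2 : (1 - 1 / (n : ℝ) ^ C) * (2 : ℝ) ^ (n - 1) < (2 : ℝ) ^ (n - 1) := by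
    have : (0 : ℝ) < (2 : ℝ) ^ (n - 1) := by positivity
    nlinarith
  linarith

/-- **`closes`** — the node decides the rung leaf BY NAME through the cone's `ExactnessDial.closes`:
the piece and the declared lift give the junction `PolyLossOddU3` (hence `NoPerfectOdd3` and `MassStep3u`), the
landed `exactnessDial_oddToAll3` and `exactnessDial_multiRingBridge3` discharge the closed items, and the cone's
declared residual `DPLift3` (26124) is carried as a hypothesis exactly as in g12's `closes_min`. -/
theorem closes (hP : BinPointerLoss3) (hL : PointerLift3) (hD : ExactnessDial.DPLift3) :
    Summit.QuantumAdvantage.AdviceFreeQNC0.AdviceFreeQNC0Three :=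
  ExactnessDial.closes (noPerfectOdd3_of_polyLossOddU3 (hL hP)) (fun _ => hL hP)
    Theorems.ExactnessDialOddToAll.exactnessDial_oddToAll3 hD Theorems.exactnessDial_multiRingBridge3

/-- the same from the junction alone (what the two pieces jointly assert). -/
theorem closes_T (hT : ExactnessDial.PolyLossOddU3) (hD : ExactnessDial.DPLift3) :
    Summit.QuantumAdvantage.AdviceFreeQNC0.AdviceFreeQNC0Three :=
  closes (node_iff.1 hT).1 (node_iff.1 hT).2 hD

end HolonomyDial

end Summit.QuantumAdvantage.QuantumAdvantage.Theorems
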